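import Literature.Probability.RandomPlanarGeometry.HexSAWBrickWallStripFugacityLevel0Locality
import Literature.Probability.RandomPlanarGeometry.HexSAWSurfaceYcLimitAllY
import HarnessLib

/-!
# Honeycomb strips with the PRINTED surface fugacity: the strip → half-plane limit `μ_T(y,1) → μ(y)` (BBdGDCG14 Prop. 7)

Topic `Literature/Probability/RandomPlanarGeometry` (lane «pcv-sawmu», a-idea-1 gen 22, door S7 «HEX-STRIP-LIMIT-PRINTED»; ed.5 a-idea-1 gen 25: eleven docstrings added, code verbatim; ed.4 a-idea-1
gen 24: imports `HexSAWBrickWallStripFugacityLevel0Locality` and drops the two re-proved lift lemmas, otherwise ed.3 verbatim;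
continues `HexSAWBrickWallStripFugacityLevel0.lean` (`HexBW.bottomVisits₀`, `HexBW.stripZ₀ = C_{T,n}(y,1)`,
`HexBW.stripMuY₀ = μ_T(y,1)`), the wall-bridge file `HexSAWSurfaceWallBridges.lean` (`HexBW.Wall.wbr`, `HexBW.Wall.WB`,
`HexBW.Wall.jcat`, `HexBW.Wall.wallRate = β(y)`, `HexBW.Wall.Cw_le`), `HexSAWSurfaceYcLimitAllY.lean` (`HV.surfaceMu y = μ(y)
= max(β(y), μ)`, `HV.tendsto_hpCoeff_rpow`, `HV.surfaceMu_eq_iff`) and `HexSAWBrickWallStripLocality.lean`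
(`HexBW.tendsto_stripConnectiveConstant : μ(S_T) → μ`)).
Source: N. R. Beaton, M. Bousquet-Mélou, J. de Gier, H. Duminil-Copin, A. J. Guttmann, *The critical fugacity for surface
adsorption of self-avoiding walks on the honeycomb lattice is `1 + √2`*, Comm. Math. Phys. 326 (2014), arXiv:1109.0358v5:
§3.2 p. 10 (`C_{T,k}(y,z)`, `μ_T(y,z)`), Proposition 7 p. 11 ("`μ_T(y) < μ_{T+1}(y)` and `μ_T(y) → μ(y)` as `T → ∞`";
proof pp. 11–12: "The proof uses arguments similar to Sections 5 and 6 of [JvROW06]" … "arches in a strip of height `T`,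
interacting with the bottom line of the strip" (p. 11); "The proof that `μ_T(y)` tends to `μ(y)` is analogous to the proof of
Theorem 6.5 in [JvROW06]" (p. 12) — [JvROW06] = E. J. Janse van Rensburg, E. Orlandini, S. G. Whittington, J. Phys. A 39
(2006) 13869 (not held; the printed convergence mechanism is by reference to it); Corollary 8 p. 12 ("`ρ_T(y)` decreases to
`ρ(y) := 1/μ(y)`"; "In particular, `ρ_T(y)` decreases to `ρ := 1/μ` for `y ≤ y_c`") with Theorem 2 p. 3 (`y_c = 1 + √2`));
the proof BELOW is the lane's surface-bridge route in the manner of J. M. Hammersley, G. M. Torrie, S. G. Whittington,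
J. Phys. A 15 (1982) 539, §2 (surface bridges, `(2.4)`–`(2.10)`; equation numbers per HTW82 as reported, unverified — not held);
N. Madras, G. Slade, *The Self-Avoiding Walk* (1993), §1.2 Lemma 1.2.2 p. 9, §8.2 (8.2.2)–(8.2.3) p. 267.

## What is proved

For the PRINTED one-level weight of `HexSAWBrickWallStripFugacityLevel0.lean` (fugacity `y` on the level-`0` vertices =
bottom row AND odd abscissa) and every `y > 0`:

* **`HexBW.tendsto_stripMuY₀`** — `μ_T(y,1) → μ(y)` as `T → ∞`, where `μ(y) = HV.surfaceMu y = max(β(y), μ)` is the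
  half-plane surface growth rate of `HexSAWSurfaceYcLimitAllY.lean` (`HV.tendsto_hpCoeff_rpow : (C⁺_n(y))^{1/n} → μ(y)`):
  the second sentence of Proposition 7, AS PRINTED, for all `y > 0`;
* `HexBW.stripMuY₀_le_surfaceMu` — `μ_T(y,1) ≤ μ(y)` for every `T` (cut at the FIRST level-`0` vertex: a reversed free
  prefix and a wall-adsorbed suffix, `C_{T,n}(y,1) ≤ c_n(S_T) + y Σ_k c_k C^w_{n-k}(y)`);
* `HexBW.rpow_mul_WB_le_stripMuY₀` — `(y B^w_m(y))^{1/(m+2)} ≤ μ_T(y,1)` for `m ≤ T` (wall bridges of span `m` have depth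
  `≤ m ≤ T`; junction-concatenation keeps the depth, so their powers embed in the strip), whence
  `HexBW.eventually_lt_stripMuY₀_of_lt_wallRate` (`a < β(y) ⇒ a < μ_T(y,1)` for `T` large);
* the desorbed half of the lower bound `HexBW.eventually_lt_stripMuY₀_of_lt_hex` from the TREE's
  `HexBW.stripConnectiveConstant_le_stripMuY₀_succ` (`μ(S_T) ≤ μ_{T+1}(y,1)`, `HexSAWBrickWallStripFugacityLevel0Locality.lean`,
  landed 2026-08-23 — ed.4 of this file imports it instead of re-proving it: the ed.3 copies collided by name) and
  `HexBW.tendsto_stripConnectiveConstant`;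
* `HexBW.iSup_stripMuY₀` (`sup_T μ_T(y,1) = μ(y)`) and `HexBW.tendsto_stripMuY₀_of_le` (`y ≤ 1 + √2 ⇒ μ_T(y,1) → μ`,
  by `HV.surfaceMu_eq_iff`).

Not used: the strict monotonicity `μ_T(y,1) < μ_{T+1}(y,1)` (first sentence of Proposition 7; successor leaf
`HexSAWBrickWallStripFugacityLevel0Strict.lean` of a-p5).  For the row-weighted two-level variant `HexBW.stripMuY` of
`HexSAWBrickWallStripFugacity.lean` the limit sentence is FALSE for `y > 2 + √2` (audit cell
`HexSAWStripFugacityConvention.lean`: `y ≤ HexBW.stripMuY T y` whereas `μ(y) ≤ √y·μ`); the present file is about the printed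
weight only.
-/

noncomputable section

open Finset Filter Function
open Literature.Probability.LatticeModels Literature.Probability.Percolation SimpleGraph
open _root_.Topology

namespace Literature.Probability.RandomPlanarGeometry.SAW.HexBW

open Literature.Probability.RandomPlanarGeometry.SAW.HexBW.Wall

variable {y : ℝ}

/-! ### Brick-wall arithmetic: odd re-basings and the parity clock along a placed walk -/

/-- `z ↦ t + negY z` is a brick-wall automorphism when `t` has ODD coordinate sum.
[cite: DuminilCopinSmirnov2012, §3 (the hexagonal lattice as a brick wall)] -/
theorem adj_add_negY_iff_of_odd {t : Site 2} (ht : (t 0 + t 1) % 2 = 1) (x z : Site 2) :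
    brickWallGraph.Adj (t + negY x) (t + negY z) ↔ brickWallGraph.Adj x z := by
  simp only [brickWallGraph_adj_coord, Pi.add_apply, negY_apply_zero, negY_apply_one]
  omega

/-- Re-basing at a site `a + c` of ODD coordinate sum: `x ↦ negY (x - c)` carries the edges of the placed walk `a + ·`
to brick-wall edges. [cite: DuminilCopinSmirnov2012, §3 (the hexagonal lattice as a brick wall)] -/
theorem adj_negY_sub_sub_iff {a c x z : Site 2} (hc : ((a + c) 0 + (a + c) 1) % 2 = 1) :
    brickWallGraph.Adj (negY (x - c)) (negY (z - c)) ↔ brickWallGraph.Adj (a + x) (a + z) := by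
  simp only [brickWallGraph_adj_coord, Pi.add_apply, Pi.sub_apply, negY_apply_zero, negY_apply_one] at hc ⊢
  omega

/-- The parity clock: along a brick-wall walk the coordinate sum alternates.
[cite: DuminilCopinSmirnov2012, §3 (bipartite brick wall)] -/
theorem parity_of_isBW {n : ℕ} {w : ℕ → Site 2} (hw : IsBW n w) {i : ℕ} (hi : i ≤ n) :
    (w i 0 + w i 1) % 2 = (w 0 0 + w 0 1 + i) % 2 := by
  induction i with
  | zero => simp
  | succ i ih =>
    have h := parity_of_adj (hw i (by omega))
    have ih' := ih (by omega)
    rw [h]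
    push_cast
    omega

/-- `visits` as a sum of indicators. [cite: HammersleyTorrieWhittington1982, §2 (surface visits)] -/
theorem visits_eq_sum (b : ℕ) (Q : ℕ → Site 2) :
    visits b Q = ∑ j ∈ range b, if (j + 1) % 2 = 0 ∧ Q (j + 1) 1 = 0 then 1 else 0 := by
  induction b with
  | zero => simp [visits]
  | succ b ih => rw [visits_succ, Finset.sum_range_succ, ih]

/-! ### Depth-restricted wall bridges and their embedding in the strip -/

open Classical in
/-- Wall bridges of span `n` whose depth is at most `d` (`-d ≤ Y_i`).
[cite: HammersleyTorrieWhittington1982, §2 (surface bridges)] -/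
def wbrD (n d : ℕ) : Finset (ℕ → Site 2) := (wbr n).filter fun ω => ∀ i ≤ n, -(d : ℤ) ≤ ω i 1

/-- `B^w_{n,d}(y)`: the weighted count of wall bridges of span `n` and depth `≤ d`.
[cite: HammersleyTorrieWhittington1982, §2 (2.4) (bridge generating function, truncated in depth)] -/
def WBD (n d : ℕ) (y : ℝ) : ℝ := ∑ ω ∈ wbrD n d, y ^ visits n ω

/-- Membership in `wbrD n d`: a wall bridge of span `n` staying at height `≥ −d`. [cite: HammersleyTorrieWhittington1982, §2 (2.4) (surface bridges truncated in depth)] -/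
theorem mem_wbrD {n d : ℕ} {ω : ℕ → Site 2} : ω ∈ wbrD n d ↔ ω ∈ wbr n ∧ ∀ i ≤ n, -(d : ℤ) ≤ ω i 1 := by
  classical
  exact Finset.mem_filter

/-- `wbrD n d ⊆ wbr n`. [cite: HammersleyTorrieWhittington1982, §2 (2.4) (surface bridges truncated in depth)] -/
theorem wbrD_subset (n d : ℕ) : wbrD n d ⊆ wbr n := fun _ h => (mem_wbrD.1 h).1

/-- `B^w_{n,d}(y) ≥ 0` for `y ≥ 0`. [cite: HammersleyTorrieWhittington1982, §2 (2.4) (surface bridges truncated in depth)] -/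
theorem WBD_nonneg (n d : ℕ) (hy : 0 ≤ y) : 0 ≤ WBD n d y := Finset.sum_nonneg fun _ _ => pow_nonneg hy _

/-- `B^w_{n,d}(y) ≤ B^w_n(y)`. [cite: HammersleyTorrieWhittington1982, §2 (2.4)] -/
theorem WBD_le_WB (n d : ℕ) (hy : 0 ≤ y) : WBD n d y ≤ WB n y :=
  Finset.sum_le_sum_of_subset_of_nonneg (wbrD_subset n d) fun _ _ _ => pow_nonneg hy _

/-- A wall bridge of span `n` has depth `≤ n`. [cite: HammersleyTorrieWhittington1982, §2 (surface bridges)] -/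
theorem wbrD_self (n : ℕ) : wbrD n n = wbr n := by
  classical
  refine Finset.filter_true_of_mem fun ω hω i hi => ?_
  have hωs := hpw_subset (archs_subset (wbr_subset hω))
  obtain ⟨h0, -, hadj, -⟩ := Zd.mem_saws.1 (saws_subset _ hωs)
  have h := Zd.abs_apply_le_of_adj h0 hadj i hi 1
  have := (abs_le.1 h).1
  omega

/-- `B^w_{n,n}(y) = B^w_n(y)`. [cite: HammersleyTorrieWhittington1982, §2 (2.4)] -/
theorem WBD_self (n : ℕ) (y : ℝ) : WBD n n y = WB n y := by rw [WBD, wbrD_self, WB]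

/-- Junction-concatenation keeps the depth. [cite: HammersleyTorrieWhittington1982, §2 (concatenation of surface bridges)] -/
theorem jcat_depth {n₁ n₂ d : ℕ} {ω υ : ℕ → Site 2} (hω : ω ∈ wbrD n₁ d) (hυ : υ ∈ wbrD n₂ d) :
    ∀ i ≤ n₁ + (2 + n₂), -(d : ℤ) ≤ jcat n₁ ω υ i 1 := by
  obtain ⟨hωb, hωd⟩ := mem_wbrD.1 hω
  obtain ⟨hυb, hυd⟩ := mem_wbrD.1 hυ
  obtain ⟨-, -, hend0⟩ := mem_archs.1 (wbr_subset hωb)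
  have hυ0 : υ 0 = 0 := (mem_saws_iff.1 (hpw_subset (archs_subset (wbr_subset hυb)))).1
  have hT0 : tailPiece υ 0 = 0 := (mem_saws_iff.1 (tailPiece_spec hυb).1).1
  intro i hi
  rcases le_or_gt i n₁ with h | h
  · rw [jcat, Zd.concatWalk_apply_of_le _ _ h]; exact hωd i h
  · obtain ⟨j, rfl⟩ : ∃ j, i = n₁ + j := ⟨i - n₁, by omega⟩
    rw [jcat, Zd.concatWalk_apply_add _ _ hT0 j, Pi.add_apply, hend0, zero_add]
    rcases le_or_gt j 2 with hj | hj
    · rw [tailPiece_apply_one_of_le υ hj]; omega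
    · obtain ⟨j', rfl⟩ : ∃ j', j = 2 + j' := ⟨j - 2, by omega⟩
      rw [tailPiece_apply_add_one hυ0 j']
      exact hυd j' (by omega)

/-- **Supermultiplicativity at fixed depth**: `y · B^w_{n₁,d}(y) · B^w_{n₂,d}(y) ≤ B^w_{n₁+2+n₂,d}(y)` (the junction walk of
`HexBW.Wall.mul_WB_le` keeps `Y ≥ -d`). [cite: HammersleyTorrieWhittington1982, §2 (2.5)–(2.6) (bridge concatenation)] -/
theorem mul_WBD_le (n₁ n₂ d : ℕ) (hy : 0 ≤ y) : y * WBD n₁ d y * WBD n₂ d y ≤ WBD (n₁ + (2 + n₂)) d y := by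
  classical
  have hinj : Set.InjOn (fun p : (ℕ → Site 2) × (ℕ → Site 2) => jcat n₁ p.1 p.2) ↑(wbrD n₁ d ×ˢ wbrD n₂ d) := by
    rintro ⟨ω, υ⟩ hp ⟨ω', υ'⟩ hp' h
    rw [Finset.mem_coe, Finset.mem_product] at hp hp'
    dsimp only at h
    have h1w := wbrD_subset _ _ hp.1
    have h2w := wbrD_subset _ _ hp.2
    have h1w' := wbrD_subset _ _ hp'.1
    have h2w' := wbrD_subset _ _ hp'.2
    have hωs := hpw_subset (archs_subset (wbr_subset h1w))
    have hω's := hpw_subset (archs_subset (wbr_subset h1w'))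
    have hυs := hpw_subset (archs_subset (wbr_subset h2w))
    have hυ's := hpw_subset (archs_subset (wbr_subset h2w'))
    obtain ⟨h1, h2⟩ := Zd.concatWalk_injective_pieces (saws_subset _ hωs) (saws_subset _ (tailPiece_spec h2w).1)
      (saws_subset _ hω's) (saws_subset _ (tailPiece_spec h2w').1) h
    have h3 := tailPiece_injective (mem_saws_iff.1 hυs).1 (mem_saws_iff.1 hυ's).1 h2
    simp only [Prod.mk.injEq]
    exact ⟨h1, h3⟩
  calc y * WBD n₁ d y * WBD n₂ d y
      = ∑ ω ∈ wbrD n₁ d, ∑ υ ∈ wbrD n₂ d, y * y ^ visits n₁ ω * y ^ visits n₂ υ := by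
        simp only [WBD, Finset.mul_sum, Finset.sum_mul]
        exact Finset.sum_comm
    _ = ∑ ω ∈ wbrD n₁ d, ∑ υ ∈ wbrD n₂ d, y ^ (visits n₁ ω + visits n₂ υ + 1) := by
        refine Finset.sum_congr rfl fun ω _ => Finset.sum_congr rfl fun υ _ => ?_
        ring
    _ = ∑ p ∈ wbrD n₁ d ×ˢ wbrD n₂ d, y ^ visits (n₁ + (2 + n₂)) (jcat n₁ p.1 p.2) := by
        rw [Finset.sum_product]
        refine Finset.sum_congr rfl fun ω hω => Finset.sum_congr rfl fun υ hυ => ?_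
        dsimp only
        rw [(jcat_spec (wbrD_subset _ _ hω) (wbrD_subset _ _ hυ)).2]
    _ = ∑ ζ ∈ (wbrD n₁ d ×ˢ wbrD n₂ d).image (fun p => jcat n₁ p.1 p.2), y ^ visits (n₁ + (2 + n₂)) ζ :=
        (Finset.sum_image (f := fun ζ => y ^ visits (n₁ + (2 + n₂)) ζ) hinj).symm
    _ ≤ WBD (n₁ + (2 + n₂)) d y := by
        refine Finset.sum_le_sum_of_subset_of_nonneg (fun ζ hζ => ?_) fun _ _ _ => pow_nonneg hy _
        obtain ⟨p, hp, rfl⟩ := Finset.mem_image.1 hζ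
        rw [Finset.mem_product] at hp
        exact mem_wbrD.2 ⟨(jcat_spec (wbrD_subset _ _ hp.1) (wbrD_subset _ _ hp.2)).1, jcat_depth hp.1 hp.2⟩

/-- Powers at fixed depth: `(y B^w_{m,d}(y))^{k+1} ≤ y B^w_{(m+2)k+m,d}(y)`.
[cite: HammersleyTorrieWhittington1982, §2 (2.5)–(2.6)] -/
theorem pow_mul_WBD_le (m d : ℕ) (hy : 0 ≤ y) (k : ℕ) :
    (y * WBD m d y) ^ (k + 1) ≤ y * WBD ((m + 2) * k + m) d y := by
  induction k with
  | zero => simp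
  | succ k ih =>
    have hW : 0 ≤ y * WBD m d y := mul_nonneg hy (WBD_nonneg m d hy)
    have h := mul_WBD_le ((m + 2) * k + m) m d hy
    rw [show (m + 2) * k + m + (2 + m) = (m + 2) * (k + 1) + m by ring] at h
    calc (y * WBD m d y) ^ (k + 1 + 1) = (y * WBD m d y) ^ (k + 1) * (y * WBD m d y) := pow_succ _ _
      _ ≤ y * WBD ((m + 2) * k + m) d y * (y * WBD m d y) := mul_le_mul_of_nonneg_right ih hW
      _ = y * (y * WBD ((m + 2) * k + m) d y * WBD m d y) := by ring
      _ ≤ y * WBD ((m + 2) * (k + 1) + m) d y := mul_le_mul_of_nonneg_left h hy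

/-- The starting site `(1, 0)` of the embedded wall bridges: a level-`0` vertex (bottom row, odd abscissa).
[cite: BeatonBousquetMelouDeGierDuminilCopinGuttmann2014, §3.2 (arXiv v5 p. 10: walks from just below the bottom of the strip)] -/
def bot₁ : Site 2 := fun j => if j = 0 then 1 else 0

/-- The abscissa of `bot₁` is `1`. [cite: BeatonBousquetMelouDeGierDuminilCopinGuttmann2014, §3.2 (arXiv v5 p. 10: walks attached to the bottom of the strip); lane bookkeeping] -/
@[simp] theorem bot₁_apply_zero : bot₁ 0 = 1 := rfl

/-- The ordinate of `bot₁` is `0` (bottom row). [cite: BeatonBousquetMelouDeGierDuminilCopinGuttmann2014, §3.2 (arXiv v5 p. 10: walks attached to the bottom of the strip); lane bookkeeping] -/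
@[simp] theorem bot₁_apply_one : bot₁ 1 = 0 := by simp [bot₁]

/-- `bot₁` is an admissible starting site of the strip of height `T`. [cite: BeatonBousquetMelouDeGierDuminilCopinGuttmann2014, §3.2 (arXiv v5 p. 10: walks attached to the bottom of the strip); lane bookkeeping] -/
theorem bot₁_mem_stripStarts (T : ℕ) : bot₁ ∈ stripStarts T :=
  mem_stripStarts.2 ⟨⟨by rw [bot₁_apply_zero]; norm_num, by rw [bot₁_apply_zero]⟩,
    ⟨by rw [bot₁_apply_one], by rw [bot₁_apply_one]; positivity⟩⟩

/-- `negY ∘ ω` is a `ℤ²` SAW. [cite: MadrasSlade1993, §1.2 (lattice symmetries)] -/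
theorem negY_comp_mem_saws {N : ℕ} {ω : ℕ → Site 2} (hω : ω ∈ saws N) :
    (fun i => negY (ω i)) ∈ Zd.saws 2 N := by
  obtain ⟨h0, hend, hadj, hinj⟩ := Zd.mem_saws.1 (saws_subset _ hω)
  refine Zd.mem_saws.2 ⟨by simp only [h0, negY_zero], fun i hi => by simp only [hend i hi],
    fun i hi => (zd_adj_negY_iff _ _).2 (hadj i hi), fun i hi j hj hij => hinj hi hj (negY_injective hij)⟩

/-- The reflected wall walk `i ↦ (1,0) + negY (ω i)` of depth `≤ d ≤ T` is a walk of the strip `S_T`.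
[cite: BeatonBousquetMelouDeGierDuminilCopinGuttmann2014, Proposition 7 (arXiv v5 p. 11: walks interacting with the bottom line of the strip)] -/
theorem embW_mem {T N d : ℕ} (hdT : d ≤ T) {ω : ℕ → Site 2} (hω : ω ∈ hpw N) (hd : ∀ i ≤ N, -(d : ℤ) ≤ ω i 1) :
    (bot₁, fun i => negY (ω i)) ∈ stripPairs T N := by
  obtain ⟨hωs, hhp⟩ := mem_hpw.1 hω
  obtain ⟨-, -, hbw, -⟩ := mem_saws_iff.1 hωs
  refine mem_stripPairs.2 ⟨bot₁_mem_stripStarts T, negY_comp_mem_saws hωs, fun i hi => ?_, fun m hm => ?_⟩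
  · exact (adj_add_negY_iff_of_odd (t := bot₁) (by rw [bot₁_apply_zero, bot₁_apply_one]; norm_num) _ _).2 (hbw i hi)
  · have h1 := hhp m hm
    have h2 := hd m hm
    refine ⟨?_, ?_⟩ <;> simp only [Pi.add_apply, bot₁_apply_one, negY_apply_one] <;> omega

/-- The level-`0` vertices of the reflected wall walk are its surface visits, plus the starting vertex.
[cite: BeatonBousquetMelouDeGierDuminilCopinGuttmann2014, §3.2 (arXiv v5 p. 10: bc(ω), contacts with the bottom of the strip)] -/
theorem bottomVisits₀_embW {N : ℕ} {ω : ℕ → Site 2} (hω : ω ∈ saws N) :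
    bottomVisits₀ bot₁ (fun i => negY (ω i)) N = visits N ω + 1 := by
  obtain ⟨h0, -, -, -⟩ := mem_saws_iff.1 hω
  have h01 : ω 0 1 = 0 := by rw [h0]; rfl
  have hterm : ∀ m ≤ N, ((bot₁ + negY (ω m)) 1 = 0 ∧ (bot₁ + negY (ω m)) 0 % 2 = 1) ↔
      (m % 2 = 0 ∧ ω m 1 = 0) := by
    intro m hm
    have hpar := parity_apply hω hm
    simp only [Pi.add_apply, bot₁_apply_zero, bot₁_apply_one, negY_apply_zero, negY_apply_one]
    constructor
    · rintro ⟨h1, h2⟩; exact ⟨by omega, by omega⟩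
    · rintro ⟨h1, h2⟩; exact ⟨by omega, by omega⟩
  unfold bottomVisits₀
  dsimp only
  rw [Finset.sum_range_succ', visits_eq_sum, if_pos ((hterm 0 (Nat.zero_le _)).2 ⟨Nat.zero_mod 2, h01⟩)]
  congr 1
  refine Finset.sum_congr rfl fun j hj => ?_
  have hj' : j + 1 ≤ N := by have := Finset.mem_range.1 hj; omega
  have e := hterm (j + 1) hj'
  by_cases hc : (j + 1) % 2 = 0 ∧ ω (j + 1) 1 = 0
  · rw [if_pos hc, if_pos (e.2 hc)]
  · rw [if_neg hc, if_neg (mt e.1 hc)]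

/-- **Wall bridges of depth `≤ T` embed in the strip `S_T`**: `y · B^w_{N,d}(y) ≤ C_{T,N}(y,1)` for `d ≤ T`.
[cite: BeatonBousquetMelouDeGierDuminilCopinGuttmann2014, Proposition 7 (arXiv v5 p. 11: proof, arches interacting with the bottom line of the strip)] -/
theorem mul_WBD_le_stripZ₀ {T d : ℕ} (hdT : d ≤ T) (N : ℕ) (hy : 0 ≤ y) : y * WBD N d y ≤ stripZ₀ T N y := by
  classical
  have hinj : Set.InjOn (fun ω : ℕ → Site 2 => ((bot₁ : Site 2), fun i => negY (ω i))) ↑(wbrD N d) := by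
    intro ω _ ω' _ h
    have h2 := congrArg Prod.snd h
    funext i
    exact negY_injective (congrFun h2 i)
  have hmem : ∀ ω ∈ wbrD N d, ((bot₁ : Site 2), fun i => negY (ω i)) ∈ stripPairs T N := fun ω hω =>
    embW_mem hdT (archs_subset (wbr_subset (wbrD_subset _ _ hω))) (mem_wbrD.1 hω).2
  calc y * WBD N d y = ∑ ω ∈ wbrD N d, y ^ (visits N ω + 1) := by
        rw [WBD, Finset.mul_sum]; exact Finset.sum_congr rfl fun ω _ => by ring
    _ = ∑ ω ∈ wbrD N d, y ^ bottomVisits₀ bot₁ (fun i => negY (ω i)) N :=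
        Finset.sum_congr rfl fun ω hω => by
          rw [bottomVisits₀_embW (hpw_subset (archs_subset (wbr_subset (wbrD_subset _ _ hω))))]
    _ = ∑ p ∈ (wbrD N d).image (fun ω : ℕ → Site 2 => ((bot₁ : Site 2), fun i => negY (ω i))),
          y ^ bottomVisits₀ p.1 p.2 N :=
        (Finset.sum_image (f := fun p : Site 2 × (ℕ → Site 2) => y ^ bottomVisits₀ p.1 p.2 N) hinj).symm
    _ ≤ stripZ₀ T N y := Finset.sum_le_sum_of_subset_of_nonneg (fun p hp => by
        obtain ⟨ω, hω, rfl⟩ := Finset.mem_image.1 hp; exact hmem ω hω) fun _ _ _ => pow_nonneg hy _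

/-- **`(y B^w_m(y))^{1/(m+2)} ≤ μ_T(y,1)` for `m ≤ T`**: powers of the wall bridges of span `m` (depth `≤ m`) embed in
`S_T` with lengths `(m+2)(k+1) - 2`.
[cite: BeatonBousquetMelouDeGierDuminilCopinGuttmann2014, Proposition 7 (arXiv v5 pp. 11–12: μ_T(y) → μ(y), proof by reference to [JvROW06] Thm 6.5; lane: surface-bridge route in the manner of HTW82 §2)] -/
theorem rpow_mul_WB_le_stripMuY₀ (hy : 0 < y) {m T : ℕ} (hmT : m ≤ T) :
    (y * WB m y) ^ (1 / ((m : ℝ) + 2)) ≤ stripMuY₀ T y := by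
  have hW0 : 0 ≤ y * WB m y := mul_nonneg hy.le (WB_nonneg m hy.le)
  have hpow : ∀ k : ℕ, (y * WB m y) ^ (k + 1) ≤ stripZ₀ T ((m + 2) * k + m) y := fun k => by
    have h1 := pow_mul_WBD_le m m hy.le k
    rw [WBD_self] at h1
    exact h1.trans (mul_WBD_le_stripZ₀ hmT _ hy.le)
  have hsub : Tendsto (fun k : ℕ => (m + 2) * k + m) atTop atTop := by
    refine Filter.tendsto_atTop_mono (fun k => ?_) tendsto_id
    show k ≤ (m + 2) * k + m
    nlinarith
  have hZ : Tendsto (fun k : ℕ => stripZ₀ T ((m + 2) * k + m) y ^ (1 / (((m + 2) * k + m : ℕ) : ℝ))) atTop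
      (𝓝 (stripMuY₀ T y)) := (tendsto_stripZ₀_rpow T hy).comp hsub
  have he : Tendsto (fun k : ℕ => ((k : ℝ) + 1) * (1 / (((m + 2) * k + m : ℕ) : ℝ))) atTop
      (𝓝 (1 / ((m : ℝ) + 2))) := by
    have h1 : Tendsto (fun k : ℕ => ((m : ℝ) + 2) - 2 * (1 / ((k : ℝ) + 1))) atTop
        (𝓝 (((m : ℝ) + 2) - 2 * 0)) :=
      tendsto_const_nhds.sub (tendsto_const_nhds.mul tendsto_one_div_add_atTop_nhds_zero_nat)
    rw [mul_zero, sub_zero] at h1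
    have h2 := h1.inv₀ (by positivity : ((m : ℝ) + 2) ≠ 0)
    rw [← one_div] at h2
    refine h2.congr' ?_
    filter_upwards [Filter.eventually_ge_atTop 1] with k hk
    have hk1 : ((k : ℝ) + 1) ≠ 0 := by positivity
    have hN : (((m + 2) * k + m : ℕ) : ℝ) ≠ 0 := by
      have : 0 < (m + 2) * k + m := by nlinarith
      positivity
    refine inv_eq_of_mul_eq_one_right ?_
    field_simp
    push_cast
    ring
  have hg : Tendsto (fun k : ℕ => (y * WB m y) ^ (((k : ℝ) + 1) * (1 / (((m + 2) * k + m : ℕ) : ℝ)))) atTop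
      (𝓝 ((y * WB m y) ^ (1 / ((m : ℝ) + 2)))) :=
    ((Real.continuousAt_const_rpow' (a := y * WB m y) (by positivity : (1 / ((m : ℝ) + 2)) ≠ 0)).tendsto).comp he
  refine le_of_tendsto_of_tendsto' hg hZ fun k => ?_
  show (y * WB m y) ^ (((k : ℝ) + 1) * (1 / (((m + 2) * k + m : ℕ) : ℝ))) ≤ _
  rw [Real.rpow_mul hW0, ← Nat.cast_add_one, Real.rpow_natCast]
  exact Real.rpow_le_rpow (pow_nonneg hW0 _) (hpow k) (by positivity)

/-- `exp(-(u_k/k)/2) ≤ μ_T(y,1)` for `1 ≤ k` and `2k - 2 ≤ T`, where `u_k = -log(y B^w_{2k-2}(y))` is the subadditive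
sequence of `HexSAWSurfaceWallBridges.lean`. [cite: HammersleyTorrieWhittington1982, §2 (2.7)–(2.9) (Fekete for surface bridges)] -/
theorem exp_wallU_le_stripMuY₀ (hy : 0 < y) {k T : ℕ} (hk : 1 ≤ k) (hT : 2 * k - 2 ≤ T) :
    Real.exp (-(wallU y k / k) / 2) ≤ stripMuY₀ T y := by
  have h := rpow_mul_WB_le_stripMuY₀ hy hT
  have hws : y * WB (2 * k - 2) y = wallSeq y k := by rw [wallSeq, if_neg (by omega)]
  have hexp : (((2 * k - 2 : ℕ) : ℝ) + 2) = 2 * k := by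
    rw [Nat.cast_sub (by omega), Nat.cast_mul]
    push_cast
    ring
  rw [hws, hexp] at h
  convert h using 1
  rw [wallU, Real.rpow_def_of_pos (wallSeq_pos hy k)]
  congr 1
  ring

/-- `exp(-(u_k/k)/2) → β(y)`. [cite: HammersleyTorrieWhittington1982, §2 (2.9) (existence of the surface-bridge growth rate)] -/
theorem tendsto_exp_wallU (hy : 0 < y) :
    Tendsto (fun k : ℕ => Real.exp (-(wallU y k / k) / 2)) atTop (𝓝 (wallRate y)) := by
  rw [wallRate]
  exact (Real.continuous_exp.tendsto _).comp (((tendsto_wallU_div hy).neg).div_const 2)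

/-- **Adsorbed half of the lower bound**: `a < β(y) ⇒ a < μ_T(y,1)` for all large `T`.
[cite: BeatonBousquetMelouDeGierDuminilCopinGuttmann2014, Proposition 7 (arXiv v5 p. 11: μ_T(y) → μ(y))] -/
theorem eventually_lt_stripMuY₀_of_lt_wallRate (hy : 0 < y) {a : ℝ} (ha : a < wallRate y) :
    ∀ᶠ T : ℕ in atTop, a < stripMuY₀ T y := by
  obtain ⟨k, hk, hk1⟩ := (((tendsto_exp_wallU hy).eventually (lt_mem_nhds ha)).and
    (Filter.eventually_ge_atTop 1)).exists
  filter_upwards [Filter.eventually_ge_atTop (2 * k - 2)] with T hT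
  exact hk.trans_le (exp_wallU_le_stripMuY₀ hy hk1 hT)

/-! ### Desorbed half of the lower bound: `μ(S_T) ≤ μ_{T+1}(y,1)` (the tree's `stripConnectiveConstant_le_stripMuY₀_succ`) -/

/-- **Desorbed half of the lower bound**: `a < μ ⇒ a < μ_T(y,1)` for all large `T` (locality `μ(S_T) → μ`).
[cite: BeatonBousquetMelouDeGierDuminilCopinGuttmann2014, Proposition 7 (arXiv v5 p. 11: μ_T(y) → μ(y))] -/
theorem eventually_lt_stripMuY₀_of_lt_hex (hy : 0 < y) {a : ℝ} (ha : a < hexConnectiveConstant) :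
    ∀ᶠ T : ℕ in atTop, a < stripMuY₀ T y := by
  have hev := (tendsto_sub_atTop_nat 1).eventually (tendsto_stripConnectiveConstant.eventually (lt_mem_nhds ha))
  filter_upwards [hev, Filter.eventually_ge_atTop 1] with T hT hT1
  calc a < stripConnectiveConstant (T - 1) := hT
    _ ≤ stripMuY₀ (T - 1 + 1) y := stripConnectiveConstant_le_stripMuY₀_succ (T - 1) hy
    _ = stripMuY₀ T y := by rw [Nat.sub_add_cancel hT1]

/-! ### The upper bound `μ_T(y,1) ≤ μ(y)`: cut at the first level-`0` vertex -/

/-- The level-`0` test at time `m` of the placed walk `a + υ ·`.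
[cite: BeatonBousquetMelouDeGierDuminilCopinGuttmann2014, §3.2 (arXiv v5 p. 10: contacts with the bottom of the strip)] -/
def IsL0 (a : Site 2) (υ : ℕ → Site 2) (m : ℕ) : Prop := (a + υ m) 1 = 0 ∧ (a + υ m) 0 % 2 = 1

/-- The level-`0` test is decidable. [cite: BeatonBousquetMelouDeGierDuminilCopinGuttmann2014, §3.2 (arXiv v5 p. 10: contacts with the bottom of the strip); lane bookkeeping] -/
instance instDecidablePredIsL0 (a : Site 2) (υ : ℕ → Site 2) : DecidablePred (IsL0 a υ) :=
  fun m => inferInstanceAs (Decidable ((a + υ m) 1 = 0 ∧ (a + υ m) 0 % 2 = 1))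

/-- `bottomVisits₀` counts the level-`0` times (by definition). [cite: BeatonBousquetMelouDeGierDuminilCopinGuttmann2014, §3.2 (arXiv v5 p. 10: contacts with the bottom of the strip); lane bookkeeping] -/
theorem bottomVisits₀_eq_sum_isL0 (a : Site 2) (υ : ℕ → Site 2) (n : ℕ) :
    bottomVisits₀ a υ n = ∑ m ∈ range (n + 1), if IsL0 a υ m then 1 else 0 := rfl

open Classical in
/-- The FIRST level-`0` time of the placed walk (`n + 1` if there is none).
[cite: HammersleyTorrieWhittington1982, §2 (decomposition at the first surface visit)] -/
def firstL0 (a : Site 2) (υ : ℕ → Site 2) (n : ℕ) : ℕ :=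
  if h : ∃ m, m ≤ n ∧ IsL0 a υ m then Nat.find h else n + 1

/-- `firstL0 a υ n ≤ n + 1`. [cite: HammersleyTorrieWhittington1982, §2 (decomposition at the first surface visit); lane bookkeeping] -/
theorem firstL0_le (a : Site 2) (υ : ℕ → Site 2) (n : ℕ) : firstL0 a υ n ≤ n + 1 := by
  unfold firstL0
  split_ifs with h
  · exact (Nat.find_spec h).1.trans (Nat.le_succ n)
  · exact le_rfl

/-- If `firstL0 a υ n = k ≤ n`, then time `k` is a level-`0` time and no earlier time is. [cite: HammersleyTorrieWhittington1982, §2 (decomposition at the first surface visit); lane bookkeeping] -/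
theorem firstL0_spec {a : Site 2} {υ : ℕ → Site 2} {n k : ℕ} (hk : firstL0 a υ n = k) (hkn : k ≤ n) :
    IsL0 a υ k ∧ ∀ m < k, ¬ IsL0 a υ m := by
  unfold firstL0 at hk
  split_ifs at hk with h
  · subst hk
    exact ⟨(Nat.find_spec h).2, fun m hm hL => Nat.find_min h hm ⟨(le_of_lt hm).trans (Nat.find_spec h).1, hL⟩⟩
  · omega

/-- If `firstL0 a υ n = n + 1`, there is no level-`0` time `≤ n`. [cite: HammersleyTorrieWhittington1982, §2 (decomposition at the first surface visit); lane bookkeeping] -/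
theorem firstL0_eq_succ {a : Site 2} {υ : ℕ → Site 2} {n : ℕ} (hk : firstL0 a υ n = n + 1) :
    ∀ m ≤ n, ¬ IsL0 a υ m := by
  unfold firstL0 at hk
  split_ifs at hk with h
  · have := (Nat.find_spec h).1; omega
  · intro m hm hL; exact h ⟨m, hm, hL⟩

/-- The weight read on the fibre: if the first level-`0` time is `k ≤ n` and the level-`0` times after `k` are the even
surface visits of a re-based suffix `Q`, then `bottomVisits₀ = visits (n-k) Q + 1`.
[cite: HammersleyTorrieWhittington1982, §2 (decomposition at the first surface visit)] -/
theorem bottomVisits₀_of_firstL0 {a : Site 2} {υ : ℕ → Site 2} {n k : ℕ} (hk : firstL0 a υ n = k) (hkn : k ≤ n)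
    {Q : ℕ → Site 2} (hQ : ∀ j ≤ n - k, (IsL0 a υ (k + j) ↔ (j % 2 = 0 ∧ Q j 1 = 0))) :
    bottomVisits₀ a υ n = visits (n - k) Q + 1 := by
  obtain ⟨hL, hmin⟩ := firstL0_spec hk hkn
  have hz : ∑ m ∈ range k, (if IsL0 a υ m then 1 else 0) = 0 :=
    Finset.sum_eq_zero fun m hm => if_neg (hmin m (Finset.mem_range.1 hm))
  rw [bottomVisits₀_eq_sum_isL0, show n + 1 = (k + 1) + (n - k) by omega, Finset.sum_range_add,
    Finset.sum_range_succ, hz, if_pos hL, zero_add, visits_eq_sum, add_comm]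
  congr 1
  refine Finset.sum_congr rfl fun j hj => ?_
  have e := hQ (j + 1) (by have := Finset.mem_range.1 hj; omega)
  rw [show k + 1 + j = k + (j + 1) by ring]
  by_cases hc : (j + 1) % 2 = 0 ∧ Q (j + 1) 1 = 0
  · rw [if_pos hc, if_pos (e.2 hc)]
  · rw [if_neg hc, if_neg (mt e.1 hc)]

/-- The re-based SUFFIX after time `k`: `Q_j = negY (υ_{k+j} - υ_k)` (a wall walk from the origin, `Y ≤ 0`).
[cite: HammersleyTorrieWhittington1982, §2 (decomposition at the first surface visit)] -/
def sufL0 (k : ℕ) (υ : ℕ → Site 2) : ℕ → Site 2 := fun j => negY (υ (k + j) - υ k)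

/-- The re-based, REVERSED PREFIX before time `k`: `P_j = negY (υ_{k-j} - υ_k)` (a free brick-wall SAW of length `k`).
[cite: HammersleyTorrieWhittington1982, §2 (decomposition at the first surface visit)] -/
def preL0 (k : ℕ) (υ : ℕ → Site 2) : ℕ → Site 2 := fun j => negY (υ (k - j) - υ k)

/-- The suffix from the first level-`0` vertex is a wall walk, and its even surface visits are exactly the later
level-`0` vertices. [cite: HammersleyTorrieWhittington1982, §2 (decomposition at the first surface visit)] -/
theorem sufL0_mem {T n k : ℕ} {p : Site 2 × (ℕ → Site 2)} (hp : p ∈ stripPairs T n)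
    (hk : firstL0 p.1 p.2 n = k) (hkn : k ≤ n) :
    sufL0 k p.2 ∈ hpw (n - k) ∧ ∀ j ≤ n - k, (IsL0 p.1 p.2 (k + j) ↔ (j % 2 = 0 ∧ sufL0 k p.2 j 1 = 0)) := by
  obtain ⟨a, υ⟩ := p
  dsimp only at hp hk ⊢
  obtain ⟨-, hυ, hbw, hin⟩ := mem_stripPairs.1 hp
  dsimp only at hυ hbw hin
  obtain ⟨h0, hend, -, hinj⟩ := Zd.mem_saws.1 hυ
  obtain ⟨hL, -⟩ := firstL0_spec hk hkn
  have hpar : ((a + υ k) 0 + (a + υ k) 1) % 2 = 1 := by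
    simp only [IsL0] at hL; omega
  refine ⟨mem_hpw.2 ⟨mem_saws_iff.2 ⟨?_, fun i hi => ?_, fun i hi => ?_, fun i hi j hj hij => ?_⟩, fun i hi => ?_⟩,
    fun j hj => ?_⟩
  · simp [sufL0]
  · simp only [sufL0]
    rw [hend (k + i) (by omega), hend (k + (n - k)) (by omega)]
  · show brickWallGraph.Adj (negY (υ (k + i) - υ k)) (negY (υ (k + (i + 1)) - υ k))
    rw [adj_negY_sub_sub_iff hpar]
    exact hbw (k + i) (by omega)
  · have e : υ (k + i) = υ (k + j) := by
      have := negY_injective hij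
      simpa [sufL0] using this
    have hi' : i ≤ n - k := hi
    have hj' : j ≤ n - k := hj
    have := hinj (show k + i ∈ {i | i ≤ n} by simp; omega) (show k + j ∈ {i | i ≤ n} by simp; omega) e
    omega
  · have h1 := (hin (k + i) (by omega)).1
    simp only [IsL0, Pi.add_apply] at hL h1
    simp only [sufL0, negY_apply_one, Pi.sub_apply]
    omega
  · have hp1 := parity_of_isBW hbw (i := k + j) (by omega)
    have hp2 := parity_of_isBW hbw (i := k) hkn
    simp only [IsL0, sufL0, Pi.add_apply, Pi.sub_apply, negY_apply_one] at hp1 hp2 hL ⊢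
    push_cast at hp1 hp2
    constructor
    · rintro ⟨h1, h2⟩; exact ⟨by omega, by omega⟩
    · rintro ⟨h1, h2⟩; exact ⟨by omega, by omega⟩

/-- The reversed prefix up to the first level-`0` vertex is a free brick-wall SAW of length `k`.
[cite: HammersleyTorrieWhittington1982, §2 (decomposition at the first surface visit)] -/
theorem preL0_mem {T n k : ℕ} {p : Site 2 × (ℕ → Site 2)} (hp : p ∈ stripPairs T n)
    (hk : firstL0 p.1 p.2 n = k) (hkn : k ≤ n) : preL0 k p.2 ∈ saws k := by
  obtain ⟨a, υ⟩ := p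
  dsimp only at hp hk ⊢
  obtain ⟨-, hυ, hbw, -⟩ := mem_stripPairs.1 hp
  dsimp only at hυ hbw
  obtain ⟨h0, -, -, hinj⟩ := Zd.mem_saws.1 hυ
  obtain ⟨hL, -⟩ := firstL0_spec hk hkn
  have hpar : ((a + υ k) 0 + (a + υ k) 1) % 2 = 1 := by
    simp only [IsL0] at hL; omega
  refine mem_saws_iff.2 ⟨by simp [preL0], fun i hi => ?_, fun i hi => ?_, fun i hi j hj hij => ?_⟩
  · simp only [preL0, Nat.sub_eq_zero_of_le hi, Nat.sub_self]
  · show brickWallGraph.Adj (negY (υ (k - i) - υ k)) (negY (υ (k - (i + 1)) - υ k))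
    rw [adj_negY_sub_sub_iff hpar]
    have h := hbw (k - (i + 1)) (by omega)
    rw [show k - (i + 1) + 1 = k - i by omega] at h
    exact h.symm
  · have e : υ (k - i) = υ (k - j) := by
      have := negY_injective hij
      simpa [preL0] using this
    have hi' : i ≤ k := hi
    have hj' : j ≤ k := hj
    have := hinj (show k - i ∈ {i | i ≤ n} by simp; omega) (show k - j ∈ {i | i ≤ n} by simp; omega) e
    omega

/-- The cut `p ↦ (reversed prefix, suffix)` is injective on the fibre `{firstL0 = k}`.
[cite: HammersleyTorrieWhittington1982, §2 (decomposition at the first surface visit)] -/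
theorem preSuf_injOn (T n k : ℕ) (hkn : k ≤ n) :
    Set.InjOn (fun p : Site 2 × (ℕ → Site 2) => (preL0 k p.2, sufL0 k p.2))
      ↑((stripPairs T n).filter fun p => firstL0 p.1 p.2 n = k) := by
  classical
  rintro ⟨a, υ⟩ hp ⟨a', υ'⟩ hp' h
  rw [Finset.mem_coe, Finset.mem_filter] at hp hp'
  obtain ⟨hp, hk⟩ := hp
  obtain ⟨hp', hk'⟩ := hp'
  dsimp only at hp hk hp' hk'
  simp only [Prod.mk.injEq] at h
  obtain ⟨hP, hQ⟩ := h
  obtain ⟨ha, hυ, -, -⟩ := mem_stripPairs.1 hp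
  obtain ⟨ha', hυ', -, -⟩ := mem_stripPairs.1 hp'
  dsimp only at ha hυ ha' hυ'
  have h0 : υ 0 = 0 := (Zd.mem_saws.1 hυ).1
  have h0' : υ' 0 = 0 := (Zd.mem_saws.1 hυ').1
  obtain ⟨hL, -⟩ := firstL0_spec hk hkn
  obtain ⟨hL', -⟩ := firstL0_spec hk' hkn
  have hvk : υ k = υ' k := by
    have e := congrFun hP k
    simp only [preL0, Nat.sub_self, h0, h0', zero_sub] at e
    have := negY_injective e
    exact neg_injective this
  have haa : a = a' := by
    have ha0 := (mem_stripStarts.1 ha).1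
    have ha0' := (mem_stripStarts.1 ha').1
    simp only [IsL0, Pi.add_apply] at hL hL'
    rw [hvk] at hL
    funext j; revert j; rw [Fin.forall_fin_two]; exact ⟨by omega, by omega⟩
  have hυυ : υ = υ' := by
    funext m
    rcases le_or_gt m k with hm | hm
    · have e := congrFun hP (k - m)
      simp only [preL0, Nat.sub_sub_self hm] at e
      have := negY_injective e
      rw [hvk] at this
      exact sub_left_injective this
    · have e := congrFun hQ (m - k)
      simp only [sufL0, Nat.add_sub_cancel' hm.le] at e
      have := negY_injective e
      rw [hvk] at this
      exact sub_left_injective this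
  rw [haa, hυυ]

open Classical in
/-- The fibre `{firstL0 = k}` (`k ≤ n`) weighs at most `y · c_k · C^w_{n-k}(y)`.
[cite: BeatonBousquetMelouDeGierDuminilCopinGuttmann2014, Proposition 7 (arXiv v5 p. 11: proof, arches in a strip interacting with the bottom line)] -/
theorem sum_fibre_firstL0_le (T n : ℕ) (hy : 0 ≤ y) {k : ℕ} (hkn : k ≤ n) :
    ∑ p ∈ (stripPairs T n).filter (fun p => firstL0 p.1 p.2 n = k), y ^ bottomVisits₀ p.1 p.2 n
      ≤ y * (#(saws k) * Cw (n - k) y) := by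
  have hprops : ∀ p ∈ (stripPairs T n).filter (fun p => firstL0 p.1 p.2 n = k),
      preL0 k p.2 ∈ saws k ∧ sufL0 k p.2 ∈ hpw (n - k) ∧
        bottomVisits₀ p.1 p.2 n = visits (n - k) (sufL0 k p.2) + 1 := fun p hp => by
    obtain ⟨hps, hk⟩ := Finset.mem_filter.1 hp
    obtain ⟨hQ, hiff⟩ := sufL0_mem hps hk hkn
    exact ⟨preL0_mem hps hk hkn, hQ, bottomVisits₀_of_firstL0 hk hkn hiff⟩
  calc ∑ p ∈ (stripPairs T n).filter (fun p => firstL0 p.1 p.2 n = k), y ^ bottomVisits₀ p.1 p.2 n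
      = ∑ p ∈ (stripPairs T n).filter (fun p => firstL0 p.1 p.2 n = k), y * y ^ visits (n - k) (sufL0 k p.2) :=
        Finset.sum_congr rfl fun p hp => by rw [(hprops p hp).2.2, pow_succ, mul_comm]
    _ = y * ∑ p ∈ (stripPairs T n).filter (fun p => firstL0 p.1 p.2 n = k), y ^ visits (n - k) (sufL0 k p.2) := by
        rw [Finset.mul_sum]
    _ = y * ∑ q ∈ ((stripPairs T n).filter (fun p => firstL0 p.1 p.2 n = k)).image
          (fun p : Site 2 × (ℕ → Site 2) => (preL0 k p.2, sufL0 k p.2)), y ^ visits (n - k) q.2 := by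
        rw [Finset.sum_image (f := fun q : (ℕ → Site 2) × (ℕ → Site 2) => y ^ visits (n - k) q.2)
          (preSuf_injOn T n k hkn)]
    _ ≤ y * ∑ q ∈ saws k ×ˢ hpw (n - k), y ^ visits (n - k) q.2 := by
        refine mul_le_mul_of_nonneg_left (Finset.sum_le_sum_of_subset_of_nonneg (fun q hq => ?_)
          fun _ _ _ => pow_nonneg hy _) hy
        obtain ⟨p, hp, rfl⟩ := Finset.mem_image.1 hq
        exact Finset.mem_product.2 ⟨(hprops p hp).1, (hprops p hp).2.1⟩
    _ = y * (#(saws k) * Cw (n - k) y) := by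
        rw [Finset.sum_product]
        simp only [Finset.sum_const, nsmul_eq_mul, Cw]

open Classical in
/-- **The first-visit cut**: `C_{T,n}(y,1) ≤ c_n(S_T) + y · Σ_{k ≤ n} c_k · C^w_{n-k}(y)`.
[cite: BeatonBousquetMelouDeGierDuminilCopinGuttmann2014, Proposition 7 (arXiv v5 pp. 11–12: proof by reference to [JvROW06] §§5–6, Thm 6.5; lane: surface-bridge route in the manner of HTW82 §2)] -/
theorem stripZ₀_le_cut (T n : ℕ) (hy : 0 ≤ y) :
    stripZ₀ T n y ≤ stripCount T n + y * ∑ k ∈ range (n + 1), (#(saws k) : ℝ) * Cw (n - k) y := by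
  have hmaps : ∀ p ∈ stripPairs T n, firstL0 p.1 p.2 n ∈ range (n + 2) := fun p _ =>
    Finset.mem_range.2 (by have := firstL0_le p.1 p.2 n; omega)
  rw [stripZ₀, ← Finset.sum_fiberwise_of_maps_to hmaps, Finset.sum_range_succ, Finset.mul_sum, add_comm]
  refine add_le_add ?_ (Finset.sum_le_sum fun k hk => ?_)
  · calc ∑ p ∈ (stripPairs T n).filter (fun p => firstL0 p.1 p.2 n = n + 1), y ^ bottomVisits₀ p.1 p.2 n
        = ∑ p ∈ (stripPairs T n).filter (fun p => firstL0 p.1 p.2 n = n + 1), (1 : ℝ) :=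
          Finset.sum_congr rfl fun p hp => by
            obtain ⟨-, hk⟩ := Finset.mem_filter.1 hp
            have hz : ∑ m ∈ range (n + 1), (if IsL0 p.1 p.2 m then 1 else 0) = 0 :=
              Finset.sum_eq_zero fun m hm =>
                if_neg (firstL0_eq_succ hk m (by have := Finset.mem_range.1 hm; omega))
            rw [bottomVisits₀_eq_sum_isL0, hz, pow_zero]
      _ ≤ stripCount T n := by
          rw [Finset.sum_const, nsmul_eq_mul, mul_one, stripCount]
          exact_mod_cast Finset.card_filter_le _ _
  · exact sum_fibre_firstL0_le T n hy (by have := Finset.mem_range.1 hk; omega)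

/-- `n + 1 ≤ e^{2√n}`. [cite: MadrasSlade1993, §1.2 (subexponential corrections)] -/
theorem cast_add_one_le_exp_two_sqrt (n : ℕ) : ((n : ℝ) + 1) ≤ Real.exp (2 * Real.sqrt n) := by
  have h := Real.quadratic_le_exp_of_nonneg (show 0 ≤ 2 * Real.sqrt n by positivity)
  have hsq : Real.sqrt n ^ 2 = n := Real.sq_sqrt (Nat.cast_nonneg n)
  nlinarith [Real.sqrt_nonneg (n : ℝ), Nat.cast_nonneg (α := ℝ) n]

/-- **Explicit strip bound**: `C_{T,n}(y,1) ≤ (2(T+1)μ + μ²β²) · e^{22√n} · μ(y)^n` with `μ(y) = max(β(y), μ)`.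
[cite: BeatonBousquetMelouDeGierDuminilCopinGuttmann2014, Proposition 7 with Corollary 8 (arXiv v5 pp. 11–12: μ_T(y) ↑, "ρ_T(y) decreases to ρ(y)")] -/
theorem stripZ₀_le_explicit (hy : 0 < y) (T n : ℕ) :
    stripZ₀ T n y ≤ (2 * ((T : ℝ) + 1) * hexConnectiveConstant + hexConnectiveConstant ^ 2 * wallRate y ^ 2) *
      Real.exp (22 * Real.sqrt n) * HV.surfaceMu y ^ n := by
  set μ := hexConnectiveConstant with hμdef
  set β := wallRate y with hβdef
  have hM : HV.surfaceMu y = max β μ := rfl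
  set M := HV.surfaceMu y with hMdef
  have hμ : 0 < μ := hexConnectiveConstant_pos
  have hβ : 0 < β := wallRate_pos y
  have hμM : μ ≤ M := hM ▸ le_max_right _ _
  have hM0 : 0 < M := HV.surfaceMu_pos y
  have hE : ∀ c : ℝ, 0 < Real.exp c := fun c => Real.exp_pos c
  have hsq : ∀ k : ℕ, k ≤ n → Real.sqrt k ≤ Real.sqrt n := fun k hk =>
    Real.sqrt_le_sqrt (by exact_mod_cast hk)
  -- free walks: `c_k ≤ μ e^{6√n} M^k`
  have hc : ∀ k : ℕ, k ≤ n → (#(saws k) : ℝ) ≤ μ * Real.exp (6 * Real.sqrt n) * M ^ k := fun k hk => by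
    rw [card_saws]
    calc (hexSawCount k : ℝ) ≤ μ * Real.exp (6 * Real.sqrt k) * μ ^ k := hexSawCount_le_mu_mul_exp_mul_pow k
      _ ≤ μ * Real.exp (6 * Real.sqrt n) * M ^ k :=
          mul_le_mul (mul_le_mul_of_nonneg_left (Real.exp_le_exp.2 (by linarith [hsq k hk])) hμ.le)
            (pow_le_pow_left₀ hμ.le hμM k) (pow_nonneg hμ.le k) (mul_nonneg hμ.le (hE _).le)
  -- wall walks: `C^w_{n-k} ≤ (n+1)(μβ²/y) e^{12√n} M^{n-k}`
  have hCw : ∀ k : ℕ, k ≤ n → Cw (n - k) y ≤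
      ((n : ℝ) + 1) * (μ * β ^ 2 / y) * Real.exp (12 * Real.sqrt n) * M ^ (n - k) := fun k hk => by
    have hC0 : 0 ≤ μ * β ^ 2 / y := by positivity
    have h1 : ((n - k : ℕ) : ℝ) + 1 ≤ (n : ℝ) + 1 := by
      have : ((n - k : ℕ) : ℝ) ≤ n := by exact_mod_cast Nat.sub_le n k
      linarith
    have h2 : Real.exp (12 * Real.sqrt ((n - k : ℕ) : ℝ)) ≤ Real.exp (12 * Real.sqrt n) :=
      Real.exp_le_exp.2 (by nlinarith [hsq (n - k) (Nat.sub_le n k)])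
    calc Cw (n - k) y ≤ (((n - k : ℕ) : ℝ) + 1) * (μ * β ^ 2 / y) * Real.exp (12 * Real.sqrt ((n - k : ℕ) : ℝ)) *
          M ^ (n - k) := Cw_le hy (n - k)
      _ ≤ ((n : ℝ) + 1) * (μ * β ^ 2 / y) * Real.exp (12 * Real.sqrt n) * M ^ (n - k) :=
          mul_le_mul_of_nonneg_right
            (mul_le_mul (mul_le_mul_of_nonneg_right h1 hC0) h2 (hE _).le (mul_nonneg (by positivity) hC0))
            (pow_nonneg hM0.le _)
  -- each term of the cut
  have hterm : ∀ k ∈ range (n + 1), (#(saws k) : ℝ) * Cw (n - k) y ≤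
      ((n : ℝ) + 1) * (μ ^ 2 * β ^ 2 / y) * Real.exp (18 * Real.sqrt n) * M ^ n := fun k hk => by
    have hkn : k ≤ n := by have := Finset.mem_range.1 hk; omega
    have hMn : M ^ k * M ^ (n - k) = M ^ n := by rw [← pow_add, Nat.add_sub_cancel' hkn]
    have he : Real.exp (6 * Real.sqrt n) * Real.exp (12 * Real.sqrt n) = Real.exp (18 * Real.sqrt n) := by
      rw [← Real.exp_add]; congr 1; ring
    calc (#(saws k) : ℝ) * Cw (n - k) y
        ≤ (μ * Real.exp (6 * Real.sqrt n) * M ^ k) *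
            (((n : ℝ) + 1) * (μ * β ^ 2 / y) * Real.exp (12 * Real.sqrt n) * M ^ (n - k)) :=
          mul_le_mul (hc k hkn) (hCw k hkn) (Cw_nonneg _ hy.le) (by positivity)
      _ = ((n : ℝ) + 1) * (μ ^ 2 * β ^ 2 / y) * (Real.exp (6 * Real.sqrt n) * Real.exp (12 * Real.sqrt n)) *
            (M ^ k * M ^ (n - k)) := by ring
      _ = ((n : ℝ) + 1) * (μ ^ 2 * β ^ 2 / y) * Real.exp (18 * Real.sqrt n) * M ^ n := by rw [hMn, he]
  -- the no-visit part
  have hcount : (stripCount T n : ℝ) ≤ 2 * ((T : ℝ) + 1) * μ * Real.exp (22 * Real.sqrt n) * M ^ n := by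
    have h1 : (stripCount T n : ℝ) ≤ 2 * ((T : ℝ) + 1) * hexSawCount n := by exact_mod_cast stripCount_le T n
    have h2 : (hexSawCount n : ℝ) ≤ μ * Real.exp (22 * Real.sqrt n) * M ^ n :=
      calc (hexSawCount n : ℝ) ≤ μ * Real.exp (6 * Real.sqrt n) * μ ^ n := hexSawCount_le_mu_mul_exp_mul_pow n
        _ ≤ μ * Real.exp (22 * Real.sqrt n) * M ^ n :=
          mul_le_mul (mul_le_mul_of_nonneg_left (Real.exp_le_exp.2 (by nlinarith [Real.sqrt_nonneg (n : ℝ)])) hμ.le)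
            (pow_le_pow_left₀ hμ.le hμM n) (pow_nonneg hμ.le n) (mul_nonneg hμ.le (hE _).le)
    calc (stripCount T n : ℝ) ≤ 2 * ((T : ℝ) + 1) * hexSawCount n := h1
      _ ≤ 2 * ((T : ℝ) + 1) * (μ * Real.exp (22 * Real.sqrt n) * M ^ n) :=
          mul_le_mul_of_nonneg_left h2 (by positivity)
      _ = 2 * ((T : ℝ) + 1) * μ * Real.exp (22 * Real.sqrt n) * M ^ n := by ring
  -- the visit part
  have hsum : y * ∑ k ∈ range (n + 1), (#(saws k) : ℝ) * Cw (n - k) y ≤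
      μ ^ 2 * β ^ 2 * Real.exp (22 * Real.sqrt n) * M ^ n := by
    have hn2 : ((n : ℝ) + 1) ^ 2 ≤ Real.exp (4 * Real.sqrt n) := by
      have h := pow_le_pow_left₀ (by positivity) (cast_add_one_le_exp_two_sqrt n) 2
      have e : Real.exp (2 * Real.sqrt n) ^ 2 = Real.exp (4 * Real.sqrt n) := by
        rw [sq, ← Real.exp_add]; congr 1; ring
      rwa [e] at h
    have he : Real.exp (4 * Real.sqrt n) * Real.exp (18 * Real.sqrt n) = Real.exp (22 * Real.sqrt n) := by
      rw [← Real.exp_add]; congr 1; ring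
    calc y * ∑ k ∈ range (n + 1), (#(saws k) : ℝ) * Cw (n - k) y
        ≤ y * ∑ k ∈ range (n + 1), ((n : ℝ) + 1) * (μ ^ 2 * β ^ 2 / y) * Real.exp (18 * Real.sqrt n) * M ^ n :=
          mul_le_mul_of_nonneg_left (Finset.sum_le_sum hterm) hy.le
      _ = ((n : ℝ) + 1) ^ 2 * (μ ^ 2 * β ^ 2) * Real.exp (18 * Real.sqrt n) * M ^ n := by
          rw [Finset.sum_const, Finset.card_range, nsmul_eq_mul]
          push_cast
          field_simp
      _ ≤ Real.exp (4 * Real.sqrt n) * (μ ^ 2 * β ^ 2) * Real.exp (18 * Real.sqrt n) * M ^ n := by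
          have : 0 ≤ (μ ^ 2 * β ^ 2) * Real.exp (18 * Real.sqrt n) * M ^ n := by positivity
          nlinarith
      _ = μ ^ 2 * β ^ 2 * Real.exp (22 * Real.sqrt n) * M ^ n := by rw [← he]; ring
  calc stripZ₀ T n y ≤ stripCount T n + y * ∑ k ∈ range (n + 1), (#(saws k) : ℝ) * Cw (n - k) y :=
        stripZ₀_le_cut T n hy.le
    _ ≤ 2 * ((T : ℝ) + 1) * μ * Real.exp (22 * Real.sqrt n) * M ^ n +
          μ ^ 2 * β ^ 2 * Real.exp (22 * Real.sqrt n) * M ^ n := add_le_add hcount hsum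
    _ = (2 * ((T : ℝ) + 1) * μ + μ ^ 2 * β ^ 2) * Real.exp (22 * Real.sqrt n) * M ^ n := by ring

/-- **`μ_T(y,1) ≤ μ(y)` for every `T` and every `y > 0`.**
[cite: BeatonBousquetMelouDeGierDuminilCopinGuttmann2014, Proposition 7 with Corollary 8 (arXiv v5 pp. 11–12: μ_T(y) ↑, "ρ_T(y) decreases to ρ(y)")] -/
theorem stripMuY₀_le_surfaceMu (T : ℕ) (hy : 0 < y) : stripMuY₀ T y ≤ HV.surfaceMu y := by
  have hM0 : 0 < HV.surfaceMu y := HV.surfaceMu_pos y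
  have hμ0 : 0 ≤ stripMuY₀ T y := (stripMuY₀_pos T hy).le
  by_contra hlt
  push Not at hlt
  set M := HV.surfaceMu y with hMdef
  set r := (M + stripMuY₀ T y) / 2 with hr
  have hMr : M < r := by rw [hr]; linarith
  have hrμ : r < stripMuY₀ T y := by rw [hr]; linarith
  have hs : 1 < r / M := (one_lt_div hM0).2 hMr
  set C := 2 * ((T : ℝ) + 1) * hexConnectiveConstant + hexConnectiveConstant ^ 2 * wallRate y ^ 2 with hC
  obtain ⟨n, hn, hn1⟩ := ((eventually_mul_exp_sqrt_le_pow hs (yK y * C) 22).and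
    (Filter.eventually_ge_atTop 1)).exists
  have hMn : 0 < M ^ n := pow_pos hM0 n
  have key : stripMuY₀ T y ^ n ≤ r ^ n :=
    calc stripMuY₀ T y ^ n ≤ yK y * stripZ₀ T n y := pow_stripMuY₀_le T n hy hμ0
      _ ≤ yK y * (C * Real.exp (22 * Real.sqrt n) * M ^ n) :=
          mul_le_mul_of_nonneg_left (stripZ₀_le_explicit hy T n) (by linarith [one_le_yK y])
      _ = yK y * C * Real.exp (22 * Real.sqrt n) * M ^ n := by ring
      _ ≤ (r / M) ^ n * M ^ n := mul_le_mul_of_nonneg_right hn hMn.le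
      _ = r ^ n := by rw [div_pow, div_mul_cancel₀ _ hMn.ne']
  have : stripMuY₀ T y ≤ r := (pow_le_pow_iff_left₀ hμ0 (hM0.le.trans hMr.le) (by omega)).1 key
  linarith

/-! ### The theorem -/

/-- **BBdGDCG14 Proposition 7, second sentence, for the PRINTED one-level weight: `μ_T(y,1) → μ(y)` as `T → ∞`, for every
`y > 0`**, with `μ(y) = HV.surfaceMu y = max(β(y), μ)` the half-plane surface growth rate (`HV.tendsto_hpCoeff_rpow`).
[cite: BeatonBousquetMelouDeGierDuminilCopinGuttmann2014, Proposition 7 (arXiv v5 p. 11: "μ_T(y) → μ(y) as T → ∞")] -/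
theorem tendsto_stripMuY₀ (hy : 0 < y) :
    Tendsto (fun T : ℕ => stripMuY₀ T y) atTop (𝓝 (HV.surfaceMu y)) := by
  refine tendsto_order.2 ⟨fun a ha => ?_, fun a ha =>
    Filter.Eventually.of_forall fun T => (stripMuY₀_le_surfaceMu T hy).trans_lt ha⟩
  rcases lt_max_iff.1 (show a < max (wallRate y) hexConnectiveConstant from ha) with h | h
  · exact eventually_lt_stripMuY₀_of_lt_wallRate hy h
  · exact eventually_lt_stripMuY₀_of_lt_hex hy h

/-- `sup_T μ_T(y,1) = μ(y)`. [cite: BeatonBousquetMelouDeGierDuminilCopinGuttmann2014, Proposition 7 (arXiv v5 p. 11)] -/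
theorem iSup_stripMuY₀ (hy : 0 < y) : (⨆ T : ℕ, stripMuY₀ T y) = HV.surfaceMu y :=
  tendsto_nhds_unique (tendsto_atTop_ciSup (fun _ _ h => stripMuY₀_mono h hy)
    ⟨HV.surfaceMu y, by rintro _ ⟨T, rfl⟩; exact stripMuY₀_le_surfaceMu T hy⟩) (tendsto_stripMuY₀ hy)

/-- Below the critical fugacity the strip rates converge to `μ`: `y ≤ 1 + √2 ⇒ μ_T(y,1) → μ`.
[cite: BeatonBousquetMelouDeGierDuminilCopinGuttmann2014, Proposition 7 and Corollary 8 with Theorem 2 (arXiv v5 pp. 11–12 and p. 3: "The critical surface fugacity for self-avoiding walks on the honeycomb lattice is y_c = 1+√2")] -/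
theorem tendsto_stripMuY₀_of_le (hy : 0 < y) (h : y ≤ 1 + Real.sqrt 2) :
    Tendsto (fun T : ℕ => stripMuY₀ T y) atTop (𝓝 hexConnectiveConstant) := by
  rw [← (HV.surfaceMu_eq_iff hy).2 h]
  exact tendsto_stripMuY₀ hy

/-- Above the critical fugacity the strip rates converge to the wall-bridge rate `β(y) > μ`:
`1 + √2 < y ⇒ μ_T(y,1) → β(y)`. [cite: BeatonBousquetMelouDeGierDuminilCopinGuttmann2014, Proposition 7 with Theorem 2 (arXiv v5 p. 11 and p. 3: y_c = 1 + √2)] -/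
theorem tendsto_stripMuY₀_of_lt (hy : 0 < y) (h : 1 + Real.sqrt 2 < y) :
    Tendsto (fun T : ℕ => stripMuY₀ T y) atTop (𝓝 (wallRate y)) := by
  rw [← HV.surfaceMu_eq_wallRate hy h]
  exact tendsto_stripMuY₀ hy

end Literature.Probability.RandomPlanarGeometry.SAW.HexBW
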